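import Literature.NumberTheory.EllipticCurves.Rank1Residual.Typed.X5DescentSelmerModeS
import HarnessLib

/-!
# X5 (p = 2): the NON-core census rows over the tree's Selmer groups

Support file for the BSD rank-≤ 1 residual programme, class X5 (`p = 2`), unit `b2b-bsdres-sha-1`
(gen 5). Everything here is proved; the only named fact entering is Gross–Zagier–Kolyvagin (`hGZK`).

`Typed/X5DescentSelmerCore.lean` typed the CORE rows of `SHA-CENSUS.md` (`Ш[2] ≅ (ℤ/2)² ⊆ 2Ш`,
`ord₂ #Ш_an = 4`) over `Sel^(2)`, `Sel^(4)`, `Sel^(8)`. This file types the two remaining row shapes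
of the census's p = 2 column (§4.1, descent outcomes `(r, r₂ − r, s)`), so that EVERY per-curve row
of the census is, in the kernel, finitely many membership / counting statements about that curve's
own Selmer groups plus the 2-adic valuation of `#Ш_an`:

* rows `(r, 0, 0)` — SHARP AND TRIVIAL (`#Sel^(2) = 2^(r+t)`, i.e. `Ш[2] = 0`; 23 416 of the
  24 422 residual curves): `X5.descentCertificateAt_of_selmerTwo_trivial`,
  `X5.bsdp_two_of_selmerTwo_trivial` — no stabilisation hypothesis is needed, since `Ш[2] = 0`
  forces `Ш[4] = Ш[2]` (`stable_two_of_card_torsionBy_two_eq_one`);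
* rows `(r, 0, s)` with `s > 0` and `Ш[4] = Ш[2]` (the 854 curves with `Ш[2^∞] ≅ (ℤ/2)²`, where the
  Cassels–Tate pairing on `Sel^(2)` is non-degenerate on the `Ш[2]`-part — PARI's pairing / engine F):
  MODE S ONE LEVEL DOWN, `X5.stable_two_of_selmer_modeS₂` — if no `s ∈ Sel^(2)(E/ℚ)` with
  `π₂(s) ≠ 0` lies in `[2]_* Sel^(4)(E/ℚ)` then `Ш[4] = Ш[2]` — and the consumer
  `X5.bsdp_two_of_selmer_modeS₂`.

(The core rows `(0, 2, 0)` are `Typed/X5DescentSelmerCore.lean`; an isogenous curve's row is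
transported by `X5.bsdp_two_of_isIsogenous`, `Typed/X5DescentShapes.lean`.)

References: Silverman, *AEC* (2009), Thm. X.4.2; Cassels (1998), §1; Cremona (1997), §3.6.
-/

noncomputable section

open scoped Classical

open WeierstrassCurve Literature.NumberTheory.EllipticCurves

namespace Literature.NumberTheory.EllipticCurves.Rank1Residual.Typed

/-- In an additive commutative group with `#A[2] = 1`, `A[4] = A[2]` (indeed both are trivial):
`2·x ∈ A[2] = 0` whenever `4·x = 0`. [cite: SilvermanAEC2009, Thm. X.4.2(a)] -/
theorem stable_two_of_card_torsionBy_two_eq_one {A : Type*} [AddCommGroup A]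
    (h : Nat.card (AddSubgroup.torsionBy A 2) = 1) : ∀ x : A, 4 • x = 0 → 2 • x = 0 := by
  intro x hx
  have hmem2 : ∀ y : A, y ∈ AddSubgroup.torsionBy A 2 ↔ 2 • y = 0 := fun y =>
    AddSubgroup.torsionBy.nsmul_iff (n := 2)
  have hmem : 2 • x ∈ AddSubgroup.torsionBy A 2 := by
    rw [hmem2, smul_smul]
    exact hx
  have h0 : (0 : A) ∈ AddSubgroup.torsionBy A 2 := zero_mem _
  haveI : Finite (AddSubgroup.torsionBy A 2) := Nat.finite_of_card_ne_zero (by rw [h]; norm_num)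
  have hsub : Subsingleton (AddSubgroup.torsionBy A 2) := (Nat.card_eq_one_iff_unique.mp h).1
  have := hsub.elim ⟨2 • x, hmem⟩ ⟨0, h0⟩
  exact congrArg Subtype.val this

variable (W : WeierstrassCurve ℚ) [W.IsElliptic] [W.IsGloballyMinimal]

/-- Arithmetic side condition `4 ∣ 2·2` for `[2]_* : Sel^(4) → Sel^(2)` (content-free private
helper). [folklore] -/
private theorem four_dvd' : (4 : ℤ) ∣ 2 * 2 := by norm_num

omit [W.IsGloballyMinimal] in
/-- **T-2DESC count typed, general exponent: `#Ш[2] = 2^s`** from `rank E(ℚ) = r`,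
`#E(ℚ)[2] = 2^t`, `#Sel^(2)(E/ℚ) = 2^(r+t+s)` (the tree's proved `card_selmerGroup_eq_pow_rank_mul`).
[cite: SilvermanAEC2009, Thm. X.4.2(a); Cremona1997, §3.6] -/
theorem X5.card_sha_two_eq_pow_of_card_selmerTwo {r t s : ℕ} (hrank : W.mordellWeilRank = r)
    (ht : Nat.card (AddSubgroup.torsionBy W.toAffine.Point 2) = 2 ^ t)
    (hSel : Nat.card (W.selmerGroup 2) = 2 ^ (r + t + s)) :
    Nat.card (AddSubgroup.torsionBy W.sha 2) = 2 ^ s := by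
  -- transport the computable `DecidableEq ℚ` of the binder to the classical one (as in
  -- `Typed/X5DescentRoute.lean`)
  have hinst : (instDecidableEqRat : DecidableEq ℚ) = fun a b => Classical.propDecidable (a = b) :=
    Subsingleton.elim _ _
  rw [hinst] at ht
  have hpos : 0 < 2 ^ r * 2 ^ t := by positivity
  have hcard : Nat.card (AddSubgroup.torsionBy W.sha (2 : ℕ)) = 2 ^ s :=
    card_torsionBy_sha_eq_of_card_selmerGroup W 2 (a := 2 ^ r * 2 ^ t) (c := 2 ^ s)
      (by rw [hrank]; exact_mod_cast congrArg (2 ^ r * ·) ht) hpos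
      (by rw [← pow_add, ← pow_add]; exact_mod_cast hSel)
  exact_mod_cast hcard

omit [W.IsGloballyMinimal] in
/-- **Rows `(r, 0, 0)`: sharp and trivial.** `rank E(ℚ) = r`, `#E(ℚ)[2] = 2^t`,
`#Sel^(2)(E/ℚ) = 2^(r+t)` (so `Ш[2] = 0`, hence `Ш[2^∞] = 0` with no further hypothesis) and
`ord₂ #Ш_an = 0` give the X5 descent datum at `2`. [cite: SilvermanAEC2009, Thm. X.4.2(a); Cremona1997, §3.6] -/
theorem X5.descentCertificateAt_of_selmerTwo_trivial {r t : ℕ} (hrank : W.mordellWeilRank = r)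
    (ht : Nat.card (AddSubgroup.torsionBy W.toAffine.Point 2) = 2 ^ t)
    (hSel : Nat.card (W.selmerGroup 2) = 2 ^ (r + t))
    {q : ℚ} (hq : shaAn W = (q : ℂ)) (hv : padicValRat 2 q = 0) : X5.DescentCertificateAt W := by
  have hcard : Nat.card (AddSubgroup.torsionBy W.sha 2) = 2 ^ 0 :=
    X5.card_sha_two_eq_pow_of_card_selmerTwo W (s := 0) hrank ht (by simpa using hSel)
  exact X5.descentCertificateAt_of_level_one W
    (stable_two_of_card_torsionBy_two_eq_one (by simpa using hcard)) hcard hq (by simpa using hv)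

/-- **Rows `(r, 0, 0)` ⟹ `BSD(E, 2)`** granted GZK: analytic rank `≤ 1`, `#E(ℚ)[2] = 2^t`,
`#Sel^(2)(E/ℚ) = 2^(r_an + t)`, `ord₂ #Ш_an = 0`. (23 416 of the 24 422 residual curves of
conductor `< 2·10⁴` at `p = 2`.) [cite: SilvermanAEC2009, Thm. X.4.2(a); Cremona1997, §3.6] -/
theorem X5.bsdp_two_of_selmerTwo_trivial (hGZK : rank_eq_analyticRank_of_analyticRank_le_one)
    (hr : W.analyticRank ≤ 1) {t : ℕ}
    (ht : Nat.card (AddSubgroup.torsionBy W.toAffine.Point 2) = 2 ^ t)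
    (hSel : Nat.card (W.selmerGroup 2) = 2 ^ (W.analyticRank + t))
    {q : ℚ} (hq : shaAn W = (q : ℂ)) (hv : padicValRat 2 q = 0) : BSDp W 2 :=
  X5.bsdp_two_of_descentCertificateAt W hGZK hr
    (X5.descentCertificateAt_of_selmerTwo_trivial W (hGZK W hr).1 ht hSel hq hv)

omit [W.IsElliptic] [W.IsGloballyMinimal] in
/-- **Mode S one level down: `Ш[4] = Ш[2]` from the Selmer groups.** If no `s ∈ Sel^(2)(E/ℚ)`
with `π₂(s) ≠ 0` is `[2]_* z` for a `z ∈ Sel^(4)(E/ℚ)`, then every `x ∈ Ш[4]` has `2·x = 0`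
(`Sel^(4) ↠ Ш[4]` and `π₂([2]_* z) = 2·π₄(z)`). This is the reading of "the Cassels–Tate pairing
on `Sel^(2)` is non-degenerate on the `Ш[2]`-part / no `Ш`-type 2-covering lifts to an
everywhere-locally-soluble 4-covering". [cite: Cassels1998, §1; SilvermanAEC2009, Thm. X.4.2(a)] -/
theorem X5.stable_two_of_selmer_modeS₂
    (hS : ∀ s : W.selmerGroup 2, W.selmerToSha 2 s ≠ 0 →
      ¬ ∃ z : W.selmerGroup 4, W.selmerZSMul 2 four_dvd' z = s) :
    ∀ x : W.sha, 4 • x = 0 → 2 • x = 0 := by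
  intro x hx
  by_contra h2
  obtain ⟨z, rfl⟩ := W.exists_selmerToSha_eq (n := 4) (by norm_num) x (by rw [ofNat_zsmul]; exact hx)
  refine hS (W.selmerZSMul 2 four_dvd' z) ?_ ⟨z, rfl⟩
  rw [selmerToSha_selmerZSMul, ofNat_zsmul]
  exact h2

/-- **Rows `(r, 0, s)` with `Ш[4] = Ш[2]` ⟹ `BSD(E, 2)`** granted GZK (no Cassels–Tate pairing as a
hypothesis): analytic rank `≤ 1`, `#E(ℚ)[2] = 2^t`, `#Sel^(2)(E/ℚ) = 2^(r_an + t + s)`, mode S at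
levels `2 | 4` over the Selmer groups, `ord₂ #Ш_an = s`. (The 854 residual curves with
`Ш[2^∞] ≅ (ℤ/2)²`, `s = 2`.) [cite: SilvermanAEC2009, Thm. X.4.2(a); Cassels1998, §1; Cremona1997, §3.6] -/
theorem X5.bsdp_two_of_selmer_modeS₂ (hGZK : rank_eq_analyticRank_of_analyticRank_le_one)
    (hr : W.analyticRank ≤ 1) {t s : ℕ}
    (ht : Nat.card (AddSubgroup.torsionBy W.toAffine.Point 2) = 2 ^ t)
    (hSel : Nat.card (W.selmerGroup 2) = 2 ^ (W.analyticRank + t + s))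
    (hS : ∀ s : W.selmerGroup 2, W.selmerToSha 2 s ≠ 0 →
      ¬ ∃ z : W.selmerGroup 4, W.selmerZSMul 2 four_dvd' z = s)
    {q : ℚ} (hq : shaAn W = (q : ℂ)) (hv : padicValRat 2 q = s) : BSDp W 2 :=
  X5.bsdp_two_of_descentCertificateAt W hGZK hr
    (X5.descentCertificateAt_of_level_one W (X5.stable_two_of_selmer_modeS₂ W hS)
      (X5.card_sha_two_eq_pow_of_card_selmerTwo W (hGZK W hr).1 ht hSel) hq hv)

end Literature.NumberTheory.EllipticCurves.Rank1Residual.Typed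

end
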